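import Mathlib
import HarnessLib
import Summits.HubbardSuperconductivity.HubbardSuperconductivity.Theorems.KLProgrammeC4aCausticWindowCoverFree
import Summits.HubbardSuperconductivity.HubbardSuperconductivity.Theorems.KLProgrammeC4aAbsBubbleNonCooper

/-!
# Route `KLProgramme` — crux C4a, S3 brick (B4) «(B4)-UMK1», «(M4)-COVER» part 5: the cover theorem's thresholds under the ACTUAL sizes — positive, n-free
# `(η₀, τ₀, L, Δ, ω, ρ_C)` meeting EVERY threshold hypothesis of `intervalIntegral_caustic_nearCaustic_umklapp_le` for all boxes of lengths `≤ L` and radii `|ρ| ≤ ρ_C`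

Cell `gate-hubbard-kl`, seat hubbard-kl-k3c3-p3 (g30; row «implicit-function / monotonicity route for μ(n)»).  Located brick for the (C)-closer lane hubbard-kl-c4a-1
(stub (C) `stub_twoLeg_curvature` of `KLRegimeEngineV17F2`, stmt-HubbardSuperconductivity-20437), memo HOME/hubbard-kl-k3c3-p3/U1-CAUSTIC-SUP.md §10 (iv).
`…C4aCausticWindowCoverFree.exists_coverThresholds` is the abstract feasibility (nonnegative coefficients); this file instantiates it with the coefficients that actually
occur in the cover theorem (`FrameOK` (i) numbers `w = 3/200`, `Kc = 7`; `D_j = msD A₃ A₄ j`, `d = Dt − 2A`, `K₁, K₂, K₃`, `RR₁ = radialRowOneConst`, `uRowTwoConst`, `u_min`)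
and spells out the MONOTONICITY in the box lengths and in `|ρ|`:
* **`exists_coverThresholds_frame`**: there are positive `η₀, τ₀, L, Δ, ω, ρ_C` such that for all `ℓ, ℓ₁, ℓ₂ ≤ L` and `|ρ| ≤ ρ_C`: the same-direction budget
  `τ₀ + 2(D₁η₀ + |ρ|/d) ≤ 3/5`, the `hΔ` domination `τ₀ + D₁(ℓ₁ + ℓ₂) ≤ Δ ≤ 3/10`, `K₁Δ < r`, the transversal floor `0 < κ(η₀ − ℓ, Δ, |ρ|)`, the antipodal rows
  `η₀ + ℓ ≤ ω`, `L ≤ ω`, and the window budget `2ε(Δ, |ρ|, ω) < (9/400)u_min²` — LITERALLY the hypotheses `hsame`, `hΔ`, `hΔ1`, `hΔr`, `hκ`, `hω₁`, `hω₂`, `hbudget` of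
  the cover theorem for a ϑ-window of length `β − α = ℓ ≤ L` and a loop window of length `φb − φa ≤ L` (`Γ ≥ κ(β − α)` is the caller's free choice).
Elementary real arithmetic on landed constants; nothing about the model beyond the Sizes binders; nothing asserts (C), K3 or superconductivity.
References: BGM 2003 §7.1 Lemma 7.1 [cite: BenfattoGiulianiMastropietro2003]; FST II CPAM 51 (1998) §3 [cite: FeldmanSalmhoferTrubowitz1998].
-/

noncomputable section

namespace Summit.HubbardSuperconductivity.HubbardSuperconductivity.Theorems.C4a

set_option linter.dupNamespace false -- summit = problem name (single-conjunct summit), D-0017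

open Real Set
open Literature.MathematicalPhysics.QuantumLattice Literature.MathematicalPhysics.QuantumLattice.BandSectorCounting
open Literature.MathematicalPhysics.QuantumLattice.FermiRG
open Summit.HubbardSuperconductivity.HubbardSuperconductivity.Theorems.KLRegimeSplit
open Summit.HubbardSuperconductivity.HubbardSuperconductivity.Theorems.DispersionFlow
open Summit.HubbardSuperconductivity.HubbardSuperconductivity.Theorems.PerturbedFermiCurve

section Sizes

variable {K : TrigPolyC4v} {A : ℝ} (hA : ∀ p : Momentum, ∀ j ≤ 2, ‖iteratedFDeriv ℝ j (frameShift K) p‖ ≤ A) (hA20 : A ≤ 1 / 20)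
  (hd : klCurveD ≤ (bandBounds (show (-4 : ℝ) < -1.1 by norm_num) (show (-1.1 : ℝ) ≤ -0.1 by norm_num)
    (show (-0.1 : ℝ) < 0 by norm_num)).Dtmin - 2 * A)
  {μ r : ℝ} (hr : 0 < r) (hlo : (-1.1 : ℝ) < μ - r - A) (hhi : μ + r + A < -0.1)
  {A₃ A₄ : ℝ} (hA₃ : ∀ p : Momentum, ‖iteratedFDeriv ℝ 3 (frameShift K) p‖ ≤ A₃)
  (hA₄ : ∀ p : Momentum, ‖iteratedFDeriv ℝ 4 (frameShift K) p‖ ≤ A₄)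
  {K₁ K₂ K₃ : ℝ} (hK₁ : ∀ p : Momentum, ‖fderiv ℝ (frameLevel μ K) p‖ ≤ K₁) (hK₂ : ∀ p : Momentum, ‖iteratedFDeriv ℝ 2 (frameLevel μ K) p‖ ≤ K₂)
  (hK₃ : ∀ p : Momentum, ‖iteratedFDeriv ℝ 3 (frameLevel μ K) p‖ ≤ K₃)
include hA hA20 hd hr hlo hhi hA₃ hA₄ hK₁ hK₂ hK₃

/-- **THE COVER THEOREM'S THRESHOLDS EXIST UNDER THE ACTUAL SIZES** (n-free: functions of the `FrameOK`/Sizes numbers only).  Positive `η₀, τ₀, L, Δ, ω, ρ_C` with, for all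
`ℓ, ℓ₁, ℓ₂ ≤ L` and `|ρ| ≤ ρ_C`: `τ₀ + 2(D₁η₀ + |ρ|/d) ≤ 3/5`; `τ₀ + D₁(ℓ₁ + ℓ₂) ≤ Δ`; `Δ ≤ 3/10`; `K₁Δ < r`; `0 < κ(η₀ − ℓ, Δ, |ρ|)` (`w = 3/200`, `Kc = 7`); `η₀ + ℓ ≤ ω`;
`L ≤ ω`; `2ε(Δ, |ρ|, ω) < (9/400)u_min²`. -/
theorem exists_coverThresholds_frame :
    ∃ η₀ τ₀ L Δ ω ρC : ℝ, 0 < η₀ ∧ 0 < τ₀ ∧ 0 < L ∧ 0 < Δ ∧ 0 < ω ∧ 0 < ρC ∧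
      (∀ ρ : ℝ, |ρ| ≤ ρC → τ₀ + 2 * (msD A₃ A₄ 1 * η₀ + |ρ| / ((bandBounds (show (-4 : ℝ) < -1.1 by norm_num) (show (-1.1 : ℝ) ≤ -0.1 by norm_num) (show (-0.1 : ℝ) < 0 by norm_num)).Dtmin - 2 * A)) ≤ 3 / 5) ∧
      (∀ ℓ₁ ℓ₂ : ℝ, ℓ₁ ≤ L → ℓ₂ ≤ L → τ₀ + msD A₃ A₄ 1 * (ℓ₁ + ℓ₂) ≤ Δ) ∧ Δ ≤ 3 / 10 ∧ K₁ * Δ < r ∧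
      (∀ ℓ ρ : ℝ, ℓ ≤ L → |ρ| ≤ ρC → 0 < 2 / π * (((bandBounds (show (-4 : ℝ) < -1.1 by norm_num) (show (-1.1 : ℝ) ≤ -0.1 by norm_num) (show (-0.1 : ℝ) < 0 by norm_num)).Dtmin - 2 * A) * (bandBounds (show (-4 : ℝ) < -1.1 by norm_num) (show (-1.1 : ℝ) ≤ -0.1 by norm_num) (show (-0.1 : ℝ) < 0 by norm_num)).umin) *
          ((bandBounds (show (-4 : ℝ) < -1.1 by norm_num) (show (-1.1 : ℝ) ≤ -0.1 by norm_num) (show (-0.1 : ℝ) < 0 by norm_num)).umin * (3 / 200) / (4 + 2 * A) * (η₀ - ℓ - π / (2 * (bandBounds (show (-4 : ℝ) < -1.1 by norm_num) (show (-1.1 : ℝ) ≤ -0.1 by norm_num) (show (-0.1 : ℝ) < 0 by norm_num)).umin) * Δ) - π * 7 * (K₁ * Δ + |ρ|) / ((bandBounds (show (-4 : ℝ) < -1.1 by norm_num) (show (-1.1 : ℝ) ≤ -0.1 by norm_num) (show (-0.1 : ℝ) < 0 by norm_num)).Dtmin - 2 * A) ^ 2)) ∧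
      (∀ ℓ : ℝ, ℓ ≤ L → η₀ + ℓ ≤ ω) ∧ L ≤ ω ∧
      (∀ ρ : ℝ, |ρ| ≤ ρC → 2 * (2 * K₃ * Δ * msD A₃ A₄ 1 ^ 2 +
          4 * K₂ * (radialRowOneConst A ((bandBounds (show (-4 : ℝ) < -1.1 by norm_num) (show (-1.1 : ℝ) ≤ -0.1 by norm_num) (show (-0.1 : ℝ) < 0 by norm_num)).Dtmin - 2 * A) * |ρ| + msD A₃ A₄ 2 * ω) * msD A₃ A₄ 1 +
          K₂ * Δ * msD A₃ A₄ 2 +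
          K₁ * ((uRowTwoConst A A₃ ((bandBounds (show (-4 : ℝ) < -1.1 by norm_num) (show (-1.1 : ℝ) ≤ -0.1 by norm_num) (show (-0.1 : ℝ) < 0 by norm_num)).Dtmin - 2 * A) + 1 / ((bandBounds (show (-4 : ℝ) < -1.1 by norm_num) (show (-1.1 : ℝ) ≤ -0.1 by norm_num) (show (-0.1 : ℝ) < 0 by norm_num)).Dtmin - 2 * A) +
                2 * (radialRowOneConst A ((bandBounds (show (-4 : ℝ) < -1.1 by norm_num) (show (-1.1 : ℝ) ≤ -0.1 by norm_num) (show (-0.1 : ℝ) < 0 by norm_num)).Dtmin - 2 * A) - 1 / ((bandBounds (show (-4 : ℝ) < -1.1 by norm_num) (show (-1.1 : ℝ) ≤ -0.1 by norm_num) (show (-0.1 : ℝ) < 0 by norm_num)).Dtmin - 2 * A))) * |ρ| + msD A₃ A₄ 3 * ω)) < 9 / 400 * (bandBounds (show (-4 : ℝ) < -1.1 by norm_num) (show (-1.1 : ℝ) ≤ -0.1 by norm_num) (show (-0.1 : ℝ) < 0 by norm_num)).umin ^ 2) := by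
  set B := bandBounds (show (-4 : ℝ) < -1.1 by norm_num) (show (-1.1 : ℝ) ≤ -0.1 by norm_num) (show (-0.1 : ℝ) < 0 by norm_num) with hBdef
  -- signs of the sizes
  have hA0 : 0 ≤ A := (norm_nonneg _).trans (hA 0 0 (by norm_num))
  have hA₃0 : 0 ≤ A₃ := (norm_nonneg _).trans (hA₃ 0)
  have hDt : 0 < B.Dtmin - 2 * A := by have := klCurveD_pos; linarith
  have hu : 0 < B.umin := B.umin_pos
  have hK₁0 : 0 ≤ K₁ := (norm_nonneg _).trans (hK₁ 0)
  have hK₂0 : 0 ≤ K₂ := (norm_nonneg _).trans (hK₂ 0)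
  have hK₃0 : 0 ≤ K₃ := (norm_nonneg _).trans (hK₃ 0)
  have h0 : |(0 : ℝ)| < r := by simpa using hr
  have hD1 : 0 ≤ msD A₃ A₄ 1 := (norm_nonneg _).trans (norm_iteratedDeriv_levelPoint_le hA hA20 hd hlo hhi hA₃ hA₄ h0 le_rfl (by norm_num) 0)
  have hD2 : 0 ≤ msD A₃ A₄ 2 := (norm_nonneg _).trans (norm_iteratedDeriv_levelPoint_le hA hA20 hd hlo hhi hA₃ hA₄ h0 (by norm_num) (by norm_num) 0)
  have hD3 : 0 ≤ msD A₃ A₄ 3 := (norm_nonneg _).trans (norm_iteratedDeriv_levelPoint_le hA hA20 hd hlo hhi hA₃ hA₄ h0 (by norm_num) (by norm_num) 0)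
  have hRR : 0 ≤ radialRowOneConst A (B.Dtmin - 2 * A) := radialRowOneConst_nonneg hA0 hDt
  have hRR' : 0 ≤ radialRowOneConst A (B.Dtmin - 2 * A) - 1 / (B.Dtmin - 2 * A) := radialRowOneConst_sub_inv_nonneg hA0 hDt
  have hUR : 0 ≤ uRowTwoConst A A₃ (B.Dtmin - 2 * A) := uRowTwoConst_nonneg hA0 hA₃0 hDt
  have hbρ : 0 ≤ uRowTwoConst A A₃ (B.Dtmin - 2 * A) + 1 / (B.Dtmin - 2 * A) + 2 * (radialRowOneConst A (B.Dtmin - 2 * A) - 1 / (B.Dtmin - 2 * A)) := by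
    positivity
  -- the abstract feasibility with the actual coefficients
  obtain ⟨η₀, τ₀, L, Δ, ω, ρC, hη0, hτ0, hL0, hΔ0, hω0, hρ0, hsame, hΔ, hΔ1, hKΔ, hκ, hω₁, hω₂, hbud⟩ :=
    exists_coverThresholds (D₁ := msD A₃ A₄ 1) (d := B.Dtmin - 2 * A) (K₁ := K₁) (r := r) (cκ := B.umin * (3 / 200) / (4 + 2 * A))
      (cu := π / (2 * B.umin)) (cρ := π * 7 / (B.Dtmin - 2 * A) ^ 2) (aΔ := 2 * K₃ * msD A₃ A₄ 1 ^ 2 + K₂ * msD A₃ A₄ 2)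
      (bρ := 4 * K₂ * radialRowOneConst A (B.Dtmin - 2 * A) * msD A₃ A₄ 1 +
        K₁ * (uRowTwoConst A A₃ (B.Dtmin - 2 * A) + 1 / (B.Dtmin - 2 * A) + 2 * (radialRowOneConst A (B.Dtmin - 2 * A) - 1 / (B.Dtmin - 2 * A))))
      (cω := 4 * K₂ * msD A₃ A₄ 2 * msD A₃ A₄ 1 + K₁ * msD A₃ A₄ 3) (bud := 9 / 400 * B.umin ^ 2)
      hD1 hDt hK₁0 hr (by positivity) (by positivity) (by positivity) (by positivity) (by positivity) (by positivity) (by positivity)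
  refine ⟨η₀, τ₀, L, Δ, ω, ρC, hη0, hτ0, hL0, hΔ0, hω0, hρ0, ?_, ?_, hΔ1, hKΔ, ?_, ?_, hω₂, ?_⟩
  · -- same direction: monotone in `|ρ|`
    intro ρ hρ
    have h1 : |ρ| / (B.Dtmin - 2 * A) ≤ ρC / (B.Dtmin - 2 * A) := div_le_div_of_nonneg_right hρ hDt.le
    linarith
  · -- `hΔ`: monotone in the lengths
    intro ℓ₁ ℓ₂ h₁ h₂
    have h1 : msD A₃ A₄ 1 * (ℓ₁ + ℓ₂) ≤ msD A₃ A₄ 1 * (L + L) := mul_le_mul_of_nonneg_left (by linarith) hD1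
    linarith
  · -- the transversal floor: monotone in `ℓ` and `|ρ|`, positive prefactor
    intro ℓ ρ hℓ hρ
    have hpre : 0 < 2 / π * ((B.Dtmin - 2 * A) * B.umin) := by positivity
    have hcκ : 0 ≤ B.umin * (3 / 200) / (4 + 2 * A) := by positivity
    have h1 : B.umin * (3 / 200) / (4 + 2 * A) * (η₀ - L - π / (2 * B.umin) * Δ) ≤
        B.umin * (3 / 200) / (4 + 2 * A) * (η₀ - ℓ - π / (2 * B.umin) * Δ) := mul_le_mul_of_nonneg_left (by linarith) hcκ
    have h2 : π * 7 * (K₁ * Δ + |ρ|) / (B.Dtmin - 2 * A) ^ 2 ≤ π * 7 / (B.Dtmin - 2 * A) ^ 2 * (K₁ * Δ + ρC) := by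
      rw [show π * 7 * (K₁ * Δ + |ρ|) / (B.Dtmin - 2 * A) ^ 2 = π * 7 / (B.Dtmin - 2 * A) ^ 2 * (K₁ * Δ + |ρ|) by ring]
      exact mul_le_mul_of_nonneg_left (by linarith) (by positivity)
    exact mul_pos hpre (by linarith)
  · intro ℓ hℓ; linarith
  · -- the window budget: monotone in `|ρ|` (nonnegative `|ρ|`-coefficients), equal to the abstract linear form at `ρ_C`
    intro ρ hρ
    have hρ0' : 0 ≤ |ρ| := abs_nonneg ρ
    have h1 : radialRowOneConst A (B.Dtmin - 2 * A) * |ρ| ≤ radialRowOneConst A (B.Dtmin - 2 * A) * ρC := mul_le_mul_of_nonneg_left hρ hRR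
    have h2 : (uRowTwoConst A A₃ (B.Dtmin - 2 * A) + 1 / (B.Dtmin - 2 * A) + 2 * (radialRowOneConst A (B.Dtmin - 2 * A) - 1 / (B.Dtmin - 2 * A))) * |ρ| ≤
        (uRowTwoConst A A₃ (B.Dtmin - 2 * A) + 1 / (B.Dtmin - 2 * A) + 2 * (radialRowOneConst A (B.Dtmin - 2 * A) - 1 / (B.Dtmin - 2 * A))) * ρC :=
      mul_le_mul_of_nonneg_left hρ hbρ
    have h3 : 4 * K₂ * (radialRowOneConst A (B.Dtmin - 2 * A) * |ρ| + msD A₃ A₄ 2 * ω) * msD A₃ A₄ 1 ≤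
        4 * K₂ * (radialRowOneConst A (B.Dtmin - 2 * A) * ρC + msD A₃ A₄ 2 * ω) * msD A₃ A₄ 1 := by
      have : 4 * K₂ * (radialRowOneConst A (B.Dtmin - 2 * A) * |ρ| + msD A₃ A₄ 2 * ω) ≤
          4 * K₂ * (radialRowOneConst A (B.Dtmin - 2 * A) * ρC + msD A₃ A₄ 2 * ω) := mul_le_mul_of_nonneg_left (by linarith) (by positivity)
      exact mul_le_mul_of_nonneg_right this hD1
    have h4 : K₁ * ((uRowTwoConst A A₃ (B.Dtmin - 2 * A) + 1 / (B.Dtmin - 2 * A) + 2 * (radialRowOneConst A (B.Dtmin - 2 * A) - 1 / (B.Dtmin - 2 * A))) * |ρ| +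
          msD A₃ A₄ 3 * ω) ≤
        K₁ * ((uRowTwoConst A A₃ (B.Dtmin - 2 * A) + 1 / (B.Dtmin - 2 * A) + 2 * (radialRowOneConst A (B.Dtmin - 2 * A) - 1 / (B.Dtmin - 2 * A))) * ρC +
          msD A₃ A₄ 3 * ω) := mul_le_mul_of_nonneg_left (by linarith) hK₁0
    have e : 2 * K₃ * Δ * msD A₃ A₄ 1 ^ 2 + 4 * K₂ * (radialRowOneConst A (B.Dtmin - 2 * A) * ρC + msD A₃ A₄ 2 * ω) * msD A₃ A₄ 1 + K₂ * Δ * msD A₃ A₄ 2 +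
        K₁ * ((uRowTwoConst A A₃ (B.Dtmin - 2 * A) + 1 / (B.Dtmin - 2 * A) + 2 * (radialRowOneConst A (B.Dtmin - 2 * A) - 1 / (B.Dtmin - 2 * A))) * ρC +
          msD A₃ A₄ 3 * ω) =
        (2 * K₃ * msD A₃ A₄ 1 ^ 2 + K₂ * msD A₃ A₄ 2) * Δ +
          (4 * K₂ * radialRowOneConst A (B.Dtmin - 2 * A) * msD A₃ A₄ 1 +
            K₁ * (uRowTwoConst A A₃ (B.Dtmin - 2 * A) + 1 / (B.Dtmin - 2 * A) + 2 * (radialRowOneConst A (B.Dtmin - 2 * A) - 1 / (B.Dtmin - 2 * A)))) * ρC +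
          (4 * K₂ * msD A₃ A₄ 2 * msD A₃ A₄ 1 + K₁ * msD A₃ A₄ 3) * ω := by ring
    linarith

end Sizes

end Summit.HubbardSuperconductivity.HubbardSuperconductivity.Theorems.C4a

end
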